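import Summits.Ventures.HodgeRepro2.A2LefschetzSplitting
import Summits.Ventures.HodgeRepro2.A2TwelvePlanes

/-!
# A2PrimitiveNumbers — the primitive Betti numbers of the model: `dim P^k = C(2n,k) − C(2n,k−2)`

Tier-4 annex of sub-claim A2 (seat p6, cell pub-hodge-repro2); §8(d): uses an L-value-free
non-vanishing device: NO.

Row 115 splits `⋀^k = P^k ⊕ L ⋀^{k−2}` for `k ≤ n` (`exists_primitive_splitting`,
`primitive_splitting_unique`), `P^k = ker Λ ∩ ⋀^k` the primitive classes.  Here the primitive
subspace is a `Submodule` (`prim`), the splitting is the lattice identity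
`⋀^k = prim ⊔ L(⋀^{k−2})` with `prim ⊓ L(⋀^{k−2}) = ⊥` (`grading_eq_prim_sup_map`,
`disjoint_prim_map`), `L` is injective on `⋀^{k−2}` (row 102's `eq_zero_of_lef_pow_eq_zero`),
and therefore

  `dim P^k = C(2n, k) − C(2n, k − 2)`   for `2 ≤ k ≤ n`   (`finrank_prim`),

Voisin Cor. 6.26's count `b_k − b_{k−2}` as a theorem of the model; `dim P^0 = dim P^1 = 1, 2n`
(`finrank_prim_zero`, `finrank_prim_one`).  Twelve planes: `dim P^4 = 10626 − 276 = 10350`,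
`dim P^2 = 276 − 1 = 275` (`finrank_prim_four_twelve`, `finrank_prim_two_twelve`).

What stays prose: Voisin Prop. 6.22 / Cor. 6.26 as statements about the cohomology of `B`;
not on the N1 chain.
-/

namespace Summit.Ventures.HodgeRepro2.A2PrimitiveNumbers

open WeilPlanes WeilIntegral WeilCoproduct A2HardLefschetzOps A2HardLefschetzMain
  A2LefschetzSplitting

variable {ι : Type*} [DecidableEq ι] [Fintype ι]

/-- The primitive classes of degree `k`: `P^k = ker Λ_c ∩ ⋀^k`. -/
noncomputable def prim (c : ι → ℂ) (k : ℕ) : Submodule ℂ (A ι) := LinearMap.ker (lam c) ⊓ grading ι k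

/-- Membership in `P^k`. -/
theorem mem_prim {c : ι → ℂ} {k : ℕ} {x : A ι} : x ∈ prim c k ↔ lam c x = 0 ∧ x ∈ grading ι k := by
  simp [prim]

/-- `P^k ⊆ ⋀^k`. -/
theorem prim_le_grading (c : ι → ℂ) (k : ℕ) : prim c k ≤ grading ι k := inf_le_right

/-- `⋀^k = P^k ⊔ L(⋀^{k−2})` for `2 ≤ k ≤ n` (row 115's splitting as a lattice identity). -/
theorem grading_eq_prim_sup_map {c : ι → ℂ} (hc : ∀ p, c p ≠ 0) {k : ℕ} (h2 : 2 ≤ k)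
    (hk : k ≤ Fintype.card ι) :
    grading ι k = prim c k ⊔ (grading ι (k - 2)).map (lef c) := by
  apply le_antisymm
  · intro x hx
    obtain ⟨v, y, hv, hv0, hy, hxe⟩ := exists_primitive_splitting hc hk hx
    rw [hxe]
    refine Submodule.add_mem_sup ?_ ?_
    · rw [mem_prim]
      exact ⟨hv0, hv⟩
    · exact Submodule.mem_map_of_mem hy
  · refine sup_le (prim_le_grading c k) ?_
    rintro _ ⟨y, hy, rfl⟩
    have := lef_pow_mem_grading c 1 hy
    rw [pow_one] at this
    have e : k - 2 + 2 * 1 = k := by omega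
    rwa [e] at this

/-- `P^k ⊓ L(⋀^{k−2}) = ⊥` for `2 ≤ k ≤ n` (the splitting is unique). -/
theorem disjoint_prim_map {c : ι → ℂ} (hc : ∀ p, c p ≠ 0) {k : ℕ} (h2 : 2 ≤ k)
    (hk : k ≤ Fintype.card ι) : Disjoint (prim c k) ((grading ι (k - 2)).map (lef c)) := by
  rw [Submodule.disjoint_def]
  intro v hv hv'
  rw [mem_prim] at hv
  obtain ⟨y, hy, rfl⟩ := hv'
  -- two splittings of `x = L y`: `L y = L y + L 0` and `L y = 0 + L y`
  have h := primitive_splitting_unique hc h2 hk (v := lef c y) (v' := 0) (y := 0) (y' := y) hv.1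
    (map_zero _) (Submodule.zero_mem _) hy (by rw [map_zero, add_zero, zero_add])
  exact h.1

/-- `L` is injective on `⋀^{k−2}` for `k ≤ n + 1` (row 102). -/
theorem lef_injOn {c : ι → ℂ} (hc : ∀ p, c p ≠ 0) {d : ℕ} (hd : d + 1 ≤ Fintype.card ι) :
    Function.Injective ((lef c).domRestrict (grading ι d)) := by
  intro y y' h
  rw [LinearMap.domRestrict_apply, LinearMap.domRestrict_apply] at h
  have h0 : lef c ((y : A ι) - y') = 0 := by rw [map_sub, h, sub_self]
  have : ((y : A ι) - y') = 0 := by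
    refine eq_zero_of_lef_pow_eq_zero hc (Submodule.sub_mem _ y.2 y'.2) (m := 1) hd ?_
    rw [pow_one]
    exact h0
  exact Subtype.ext (sub_eq_zero.mp this)

/-- `dim L(⋀^{k−2}) = dim ⋀^{k−2} = C(2n, k−2)` for `k ≤ n + 1`. -/
theorem finrank_map_lef {c : ι → ℂ} (hc : ∀ p, c p ≠ 0) {d : ℕ} (hd : d + 1 ≤ Fintype.card ι) :
    Module.finrank ℂ ((grading ι d).map (lef c)) = (2 * Fintype.card ι).choose d := by
  rw [← LinearMap.range_domRestrict, LinearMap.finrank_range_of_inj (lef_injOn hc hd),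
    finrank_grading]

/-- THE PRIMITIVE BETTI NUMBERS OF THE MODEL: `dim P^k = C(2n, k) − C(2n, k−2)` for `2 ≤ k ≤ n`
(Voisin Cor. 6.26's `b_k − b_{k−2}`). -/
theorem finrank_prim {c : ι → ℂ} (hc : ∀ p, c p ≠ 0) {k : ℕ} (h2 : 2 ≤ k)
    (hk : k ≤ Fintype.card ι) :
    Module.finrank ℂ (prim c k) =
      (2 * Fintype.card ι).choose k - (2 * Fintype.card ι).choose (k - 2) := by
  haveI : FiniteDimensional ℂ (prim c k) :=
    Submodule.finiteDimensional_of_le (prim_le_grading c k)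
  haveI : FiniteDimensional ℂ ((grading ι (k - 2)).map (lef c)) := by
    haveI := finiteDimensional_grading (ι := ι) (k - 2)
    exact Module.Finite.map _ _
  have h := Submodule.finrank_sup_add_finrank_inf_eq (prim c k) ((grading ι (k - 2)).map (lef c))
  rw [← grading_eq_prim_sup_map hc h2 hk, (disjoint_prim_map hc h2 hk).eq_bot, finrank_bot,
    add_zero, finrank_grading, finrank_map_lef hc (by omega)] at h
  omega

/-- `P^0 = ⋀^0` (Λ kills `⋀^0`): `dim P^0 = 1`. -/
theorem finrank_prim_zero (c : ι → ℂ) : Module.finrank ℂ (prim c 0) = 1 := by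
  have h : prim c 0 = grading ι 0 := by
    apply le_antisymm (prim_le_grading c 0)
    intro x hx
    rw [mem_prim]
    exact ⟨lam_eq_zero_of_mem_lt_two c (by norm_num) hx, hx⟩
  rw [h, finrank_grading, Nat.choose_zero_right]

/-- `P^1 = ⋀^1` (Λ kills `⋀^1`): `dim P^1 = 2n`. -/
theorem finrank_prim_one (c : ι → ℂ) : Module.finrank ℂ (prim c 1) = 2 * Fintype.card ι := by
  have h : prim c 1 = grading ι 1 := by
    apply le_antisymm (prim_le_grading c 1)
    intro x hx
    rw [mem_prim]
    exact ⟨lam_eq_zero_of_mem_lt_two c (by norm_num) hx, hx⟩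
  rw [h, finrank_grading, Nat.choose_one_right]

/-- Twelve planes: `dim P^4 = C(24,4) − C(24,2) = 10350`. -/
theorem finrank_prim_four_twelve {c : A2TwelvePlanes.ι₁₂ → ℂ} (hc : ∀ p, c p ≠ 0) :
    Module.finrank ℂ (prim c 4) = 10350 := by
  rw [finrank_prim hc (by norm_num) (by rw [A2TwelvePlanes.card_twelve]; norm_num),
    A2TwelvePlanes.card_twelve]
  decide

/-- Twelve planes: `dim P^2 = C(24,2) − 1 = 275`. -/
theorem finrank_prim_two_twelve {c : A2TwelvePlanes.ι₁₂ → ℂ} (hc : ∀ p, c p ≠ 0) :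
    Module.finrank ℂ (prim c 2) = 275 := by
  rw [finrank_prim hc (by norm_num) (by rw [A2TwelvePlanes.card_twelve]; norm_num),
    A2TwelvePlanes.card_twelve]
  decide

end Summit.Ventures.HodgeRepro2.A2PrimitiveNumbers
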